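import Mathlib.CategoryTheory.Functor.ReflectsIso.Exact
import Mathlib.NumberTheory.Padics.RingHoms
import Mathlib.NumberTheory.Padics.ProperSpace
import Literature.AlgebraicGeometry.Motives.ProetCohomologyModule
import Literature.AlgebraicGeometry.Motives.EllAdicBockstein
import Literature.AlgebraicGeometry.Resolution.CompleteFiniteness
import Literature.NumberTheory.GaloisRepresentations.LocalOneUnitsProofs
import HarnessLib

/-!
# Finiteness of `ℓ`-adic cohomology, III: the coefficient sequence on `X_proét` and
# Milne V Lemma 1.11 for the pro-étale groups

Part I (`EllAdicCohomologyFiniteness.lean`) reduced the module-level finiteness statement for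
proper schemes — `Hⁱ_proét(Y, ℤ_ℓ)` (Mathlib's `Scheme.EllAdicCohomology`) carries a finitely
generated `ℤ_ℓ`-module structure for `Y` proper over a separably closed field, the explicit
conclusion of `exists_module_finite_ellAdicCohomology_of_isProper_of_facts` (a composite of
printed theorems, not itself a named fact, D-0026) — to the finiteness of the `Hʲ(Y_proét, ℤ/ℓᵐ)`
and to
`exists_module_finite_ellAdicCohomology_of_finite` = **Milne V Lemma 1.11** + the
pro-étale/continuous comparison (Bhatt–Scholze Prop. 5.6.2). Part II
(`EllAdicCohomologyFinitenessEtale.lean`, `EllAdicComparison.lean`) restated the inputs on the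
étale side, and `EllAdicBockstein.lean` proved V.1.11 for the *étale tower*
`lim_m Hⁱ(Y_ét, ℤ/ℓᵐ)`. This file proves the ingredients of V.1.11 directly for the *pro-étale*
groups `Hⁱ(Y_proét, ℤ_ℓ)` with their canonical `ℤ_ℓ`-module structure
(`ProetCohomologyModule.lean`), following the printed proof (p. 178) transcribed to `Y_proét`,
where no inverse limit has to be taken; the assembly with the named facts is
`EllAdicCohomologyFinitenessAssembly.lean`.

1. **The coefficient sequence** `0 → F_{ℤ_ℓ} —ℓᵐ→ F_{ℤ_ℓ} → F_{ℤ/ℓᵐ} → 0` is a short exact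
   sequence of abelian sheaves on `Y_proét` (`powSMulShortComplex_shortExact`; Milne's
   `0 → F_n → F_{n+s} → F_s → 0`, with `F_{ℤ_ℓ} = lim_n F_{ℤ/ℓⁿ}`, Bhatt–Scholze Lemma 6.8.2 (1)).
   It is exact already on sections over every `U` (`ℤ/ℓᵐ` is discrete, so continuous maps lift
   along any set-theoretic section of `ℤ_ℓ → ℤ/ℓᵐ`; `a ↦ ℓᵐ a` is a closed embedding of the
   compact `ℤ_ℓ`, so `g/ℓᵐ` is continuous when `g` is divisible by `ℓᵐ`), hence short exact as
   presheaves (the evaluations are exact and jointly reflect isomorphisms, Mathlib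
   `JointlyReflectIsomorphisms.shortExact_iff`), hence as sheaves (sheafification is exact and
   restricts to the identity on sheaves, `sheafificationNatIso`).
2. **The cohomology sequence** (Mathlib `Ext.covariant_sequence_exact₂` for `Sheaf.H = Ext(ℤ, –)`):
   `Hⁱ(Y_proét, ℤ_ℓ) —ℓᵐ→ Hⁱ(Y_proét, ℤ_ℓ) → Hⁱ(Y_proét, ℤ/ℓᵐ)` is exact — the kernel of the
   reduction is `ℓᵐ Hⁱ(Y_proét, ℤ_ℓ)` for the canonical action
   (`ProetCohomology.exists_pow_smul_eq_of_map_reductionHom_eq_zero`,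
   `ProetCohomology.map_reductionHom_pow_smul`); Milne's `⋯ → Hʳ(F) →ˡˢ Hʳ(F) → Hʳ(F_s) → ⋯`.
3. **The algebra** ("it follows that `Hʳ(F)` is generated by any subset that generates it
   mod `l`"): if `Hⁱ(Y_proét, ℤ/ℓ)` is finite and `Hⁱ(Y_proét, ℤ_ℓ)` is `ℓ`-adically separated, it
   is finitely generated — `M/ℓM` embeds in `Hⁱ(Y_proét, ℤ/ℓ)` by (2), and Matsumura Thm. 8.4 over
   the complete ring `ℤ_ℓ` (in the tree: `Literature.AlgebraicGeometry.Resolution.Matsumura1987_8_4_finset`)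
   lifts generators (`ProetCohomology.module_finite_of_finite_of_separated`).
4. **Separatedness in degree `0`** ("no non-zero element is divisible by all powers of `l`") holds
   unconditionally (`H⁰_proét(Y, ℤ_ℓ) = C(Y, ℤ_ℓ)`, `ProetCohomology.eq_zero_of_forall_nsmul_zero`),
   whence **degree `0` of the target fact, unconditionally**: `H⁰_proét(Y, ℤ_ℓ)` is finitely
   generated for `Y` proper over any field (`module_finite_proetCohomology_padicInt_zero_of_isProper`,
   using the proved degree-`0` finiteness `finite_proetCohomology_zmod_zero_of_isProper` of
   Part II). Separatedness in degrees `j + 1` needs the `lim¹` sequence (Bhatt–Scholze 5.6.2, a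
   named fact) and is done in the assembly file.

## References

* J. S. Milne, *Étale cohomology*, Princeton Univ. Press (2025 reissue, held copy; PDF pages):
  V §1 p. 176 (`Hʳ(X, F) := lim Hʳ(X, F_n)`, the `ℤ_l`-action); V Lemma 1.11, statement p. 177,
  proof p. 178 (the steps above). [Milne2025]
* B. Bhatt, P. Scholze, *The pro-étale topology for schemes*, Astérisque 369 (2015) (held:
  arXiv:1309.1198): Lemma 4.2.12 (`𝓕_T`; constant for discrete `T`), Def. 6.8.1,
  Lemma 6.8.2 (1) (`𝓞_{E,X} = lim_n 𝓞_E/ϖⁿ`). [BhattScholze2015]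
* H. Matsumura, *Commutative ring theory*, CUP 1986: Thm. 8.4. [Matsumura1987]

## Design notes

* Levels are `ℤ/ℓᵐ = ZMod (ℓ ^ m)` throughout (as in Parts I–II); "`Hⁱ(Y_proét, ℤ/ℓ)`" is
  `ProetCohomology Y (ZMod (ℓ ^ 1)) i`, the level `m = 1` of the hypotheses
  `∀ m j, Finite (ProetCohomology Y (ZMod (ℓ ^ m)) j)` of the Part I facts.
* The multiplication map is `DistribSMul.toAddMonoidHom ℤ_[ℓ] (ℓ ^ m)`, so that the induced map
  on `Hⁱ` is *by definition* the action of `ℓᵐ ∈ ℤ_ℓ` (`ProetCohomology.smul_def`); the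
  reduction is `PadicInt.toZModPow m` (continuity:
  `Literature.NumberTheory.GaloisRepresentations.OneUnits.continuous_toZModPow`).
* Not here: the second half `Hʳ(F_s) → Hʳ⁺¹(F)_{lˢ} → 0` of Milne's exact sequences (available
  from `Ext.covariant_sequence_exact₃/₁` in the same way; no consumer yet).
* Mathlib searches: `JointlyReflectIsomorphisms.shortExact_iff`, `ShortComplex.mapNatIso`,
  `sheafificationNatIso`, `ShortExact.map_of_exact`, `Ext.covariant_sequence_exact₂`,
  `Continuous.isClosedEmbedding`, `ZMod.ringHom_surjective`, `IsHausdorff` (all used). Literature: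
  `EllAdicBockstein.lean` does the analogous Bockstein sequences for the constant étale sheaves
  `ℤ/ℓᵐ` (reused: `pow_smul_etaleCohomologyZModPow` in the assembly); nothing on `X_proét`.
-/

universe u

open CategoryTheory AlgebraicGeometry Limits

noncomputable section

namespace Literature.AlgebraicGeometry.Motives

/-! ### The coefficient sequence `0 → F_{ℤ_ℓ} —ℓᵐ→ F_{ℤ_ℓ} → F_{ℤ/ℓᵐ} → 0` on `X_proét` -/

section ExactSequence

variable (X : Scheme.{u}) (ℓ : ℕ) [Fact ℓ.Prime] (m : ℕ)

/-- Multiplication by `ℓᵐ` on `ℤ_ℓ`, as the additive map `a ↦ ℓᵐ • a`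
(`DistribSMul.toAddMonoidHom`, so that it induces the module action of `ℓᵐ` on cohomology).
[folklore] -/
abbrev powSMulHom : ℤ_[ℓ] →+ ℤ_[ℓ] := DistribSMul.toAddMonoidHom ℤ_[ℓ] ((ℓ : ℤ_[ℓ]) ^ m)

/-- `a ↦ ℓᵐ a` is continuous. [folklore] -/
theorem continuous_powSMulHom : Continuous (powSMulHom ℓ m) :=
  continuous_const_smul _

/-- The reduction `ℤ_ℓ → ℤ/ℓᵐ` (`PadicInt.toZModPow m`) as an additive map. [folklore] -/
abbrev reductionHom : ℤ_[ℓ] →+ ZMod (ℓ ^ m) := (PadicInt.toZModPow m).toAddMonoidHom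

/-- The reduction `ℤ_ℓ → ℤ/ℓᵐ` is continuous (`ℤ/ℓᵐ` discrete; its kernel `ℓᵐℤ_ℓ` is open).
[folklore] -/
theorem continuous_reductionHom : Continuous (reductionHom ℓ m) :=
  Literature.NumberTheory.GaloisRepresentations.OneUnits.continuous_toZModPow ℓ m

/-- `ℤ_ℓ —ℓᵐ→ ℤ_ℓ → ℤ/ℓᵐ` composes to zero. [folklore] -/
theorem reductionHom_comp_powSMulHom : (reductionHom ℓ m).comp (powSMulHom ℓ m) = 0 := by
  ext a
  have h : (PadicInt.toZModPow m ((ℓ : ℤ_[ℓ]) ^ m) : ZMod (ℓ ^ m)) = 0 := by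
    rw [map_pow, map_natCast, ← Nat.cast_pow, ZMod.natCast_self]
  simp [smul_eq_mul, h]

variable {ℓ m} in
/-- `a ↦ ℓᵐ a` is injective on `ℤ_ℓ` (a domain). [folklore] -/
theorem powSMulHom_injective : Function.Injective (powSMulHom ℓ m) := by
  intro a b h
  have hℓ : ((ℓ : ℤ_[ℓ]) ^ m) ≠ 0 := pow_ne_zero _ (by exact_mod_cast (Fact.out : ℓ.Prime).ne_zero)
  simpa [smul_eq_mul, hℓ] using h

section Sections

variable {T : Type*} [TopologicalSpace T]

/-- Exactness of the coefficient sequence on sections, left: `g ↦ ℓᵐ g` is injective on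
`C(T, ℤ_ℓ)`. [folklore] -/
theorem comp_powSMulHom_injective :
    Function.Injective fun g : C(T, ℤ_[ℓ]) =>
      (⟨powSMulHom ℓ m, continuous_powSMulHom ℓ m⟩ : C(ℤ_[ℓ], ℤ_[ℓ])).comp g := by
  intro g g' h
  ext t
  exact powSMulHom_injective (DFunLike.congr_fun h t)

/-- Exactness of the coefficient sequence on sections, middle: a continuous `g : T → ℤ_ℓ` whose
reduction mod `ℓᵐ` vanishes is `ℓᵐ q` for a continuous `q` (pointwise `g = ℓᵐ c` by
`PadicInt.ker_toZModPow`; `c` is continuous because `a ↦ ℓᵐ a` is a closed embedding of the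
compact Hausdorff `ℤ_ℓ`). [folklore] -/
theorem exists_powSMulHom_comp_eq (g : C(T, ℤ_[ℓ]))
    (hg : (⟨reductionHom ℓ m, continuous_reductionHom ℓ m⟩ : C(ℤ_[ℓ], ZMod (ℓ ^ m))).comp g
      = 0) :
    ∃ q : C(T, ℤ_[ℓ]),
      (⟨powSMulHom ℓ m, continuous_powSMulHom ℓ m⟩ : C(ℤ_[ℓ], ℤ_[ℓ])).comp q = g := by
  have hmem : ∀ t, ∃ c : ℤ_[ℓ], g t = (ℓ : ℤ_[ℓ]) ^ m * c := fun t => by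
    have ht : PadicInt.toZModPow m (g t) = 0 := DFunLike.congr_fun hg t
    rw [← RingHom.mem_ker, PadicInt.ker_toZModPow, Ideal.mem_span_singleton] at ht
    exact ht
  choose c hc using hmem
  have hemb : Topology.IsClosedEmbedding (powSMulHom ℓ m) :=
    (continuous_powSMulHom ℓ m).isClosedEmbedding powSMulHom_injective
  have hcont : Continuous c := by
    rw [hemb.isInducing.continuous_iff]
    convert g.continuous using 1
    ext t
    simp [smul_eq_mul, hc t]
  exact ⟨⟨c, hcont⟩, ContinuousMap.ext fun t => by simp [smul_eq_mul, hc t]⟩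

/-- Exactness of the coefficient sequence on sections, right: every continuous `T → ℤ/ℓᵐ`
lifts to a continuous `T → ℤ_ℓ` (`ℤ/ℓᵐ` is discrete, so any set-theoretic section of the
surjection `ℤ_ℓ → ℤ/ℓᵐ` will do; Bhatt–Scholze Lemma 4.2.12: `𝓕_T` is the constant sheaf for
discrete `T`). [folklore] -/
theorem comp_reductionHom_surjective :
    Function.Surjective fun g : C(T, ℤ_[ℓ]) =>
      (⟨reductionHom ℓ m, continuous_reductionHom ℓ m⟩ : C(ℤ_[ℓ], ZMod (ℓ ^ m))).comp g := by
  intro k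
  obtain ⟨s, hs⟩ := (ZMod.ringHom_surjective (PadicInt.toZModPow (p := ℓ) m)).hasRightInverse
  exact ⟨⟨s ∘ k, continuous_of_discreteTopology.comp k.continuous⟩,
    ContinuousMap.ext fun t => hs (k t)⟩

end Sections

/-- **The coefficient sequence** `F_{ℤ_ℓ} —ℓᵐ→ F_{ℤ_ℓ} → F_{ℤ/ℓᵐ}` of abelian sheaves on `X_proét`
(lifted to `Ab.{u+1}`), as a short complex: the pro-étale transcription of Milne's
`0 → F_n → F_{n+s} → F_s → 0` for the `l`-adic sheaf `(ℤ/lⁿ)_n` (proof of V Lemma 1.11, p. 178),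
using `F_{ℤ_ℓ} = lim_n F_{ℤ/ℓⁿ}` (Bhatt–Scholze Lemma 6.8.2 (1)).
[cite: Milne2025, V Lemma 1.11 (proof, p. 178)] -/
def powSMulShortComplex : ShortComplex (Sheaf (Scheme.ProEt.topology X) Ab.{u + 1}) :=
  ShortComplex.mk (proetSheafMap X (powSMulHom ℓ m) (continuous_powSMulHom ℓ m))
    (proetSheafMap X (reductionHom ℓ m) (continuous_reductionHom ℓ m)) (by
      rw [← proetSheafMap_comp X _ _ _ _
          ((continuous_reductionHom ℓ m).comp (continuous_powSMulHom ℓ m)),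
        proetSheafMap_congr (reductionHom_comp_powSMulHom ℓ m) _ continuous_const,
        proetSheafMap_zero])

/-- The evaluation functors `F ↦ F(U)`, `U ∈ X_proét`, jointly reflect isomorphisms of
`Ab`-valued presheaves (an objectwise isomorphism of presheaves is an isomorphism). [folklore] -/
theorem evaluation_jointlyReflectIsomorphisms :
    JointlyReflectIsomorphisms
      (fun U : X.ProEtᵒᵖ => (evaluation X.ProEtᵒᵖ Ab.{u + 1}).obj U) :=
  ⟨fun f h => by
    haveI : ∀ U, IsIso (f.app U) := h
    exact NatIso.isIso_of_isIso_app f⟩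

/-- The coefficient sequence is short exact on sections over every `U ∈ X_proét`
(`comp_powSMulHom_injective`, `exists_powSMulHom_comp_eq`, `comp_reductionHom_surjective`,
through `ULift`). [folklore] -/
theorem powSMulShortComplex_sections_shortExact (U : X.ProEtᵒᵖ) :
    (((powSMulShortComplex X ℓ m).map (sheafToPresheaf _ _)).map
      ((evaluation X.ProEtᵒᵖ Ab.{u + 1}).obj U)).ShortExact where
  exact := by
    rw [ShortComplex.ab_exact_iff]
    rintro ⟨g⟩ hg
    obtain ⟨q, hq⟩ := exists_powSMulHom_comp_eq ℓ m g (congrArg ULift.down hg)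
    exact ⟨⟨q⟩, congrArg ULift.up hq⟩
  mono_f := (AddCommGrpCat.mono_iff_injective _).2 fun g g' h =>
    congrArg ULift.up (comp_powSMulHom_injective ℓ m (congrArg ULift.down h))
  epi_g := (AddCommGrpCat.epi_iff_surjective _).2 fun k => by
    obtain ⟨g, hg⟩ := comp_reductionHom_surjective ℓ m k.down
    exact ⟨⟨g⟩, congrArg ULift.up hg⟩

/-- **The coefficient sequence `0 → F_{ℤ_ℓ} —ℓᵐ→ F_{ℤ_ℓ} → F_{ℤ/ℓᵐ} → 0` is a short exact sequence
of abelian sheaves on `X_proét`.** Sections-wise short exact, hence short exact as presheaves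
(the evaluations are exact and jointly reflect isomorphisms,
`JointlyReflectIsomorphisms.shortExact_iff`), hence as sheaves: sheafification is exact and
`sheafToPresheaf ⋙ presheafToSheaf ≅ 𝟭` (`sheafificationNatIso`).
[cite: Milne2025, V Lemma 1.11 (proof, p. 178)] -/
theorem powSMulShortComplex_shortExact : (powSMulShortComplex X ℓ m).ShortExact := by
  have hP : ((powSMulShortComplex X ℓ m).map (sheafToPresheaf _ Ab.{u + 1})).ShortExact := by
    rw [(evaluation_jointlyReflectIsomorphisms X).shortExact_iff]
    exact powSMulShortComplex_sections_shortExact X ℓ m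
  exact ShortComplex.shortExact_of_iso
    ((powSMulShortComplex X ℓ m).mapNatIso
      (sheafificationNatIso (Scheme.ProEt.topology X) Ab.{u + 1})).symm
    (hP.map_of_exact (presheafToSheaf (Scheme.ProEt.topology X) Ab.{u + 1}))

/-- **Exactness of `Hⁱ(X_proét, ℤ_ℓ) —ℓᵐ→ Hⁱ(X_proét, ℤ_ℓ) → Hⁱ(X_proét, ℤ/ℓᵐ)`**: a class whose
reduction mod `ℓᵐ` vanishes is `ℓᵐ` times a class (the covariant long exact `Ext`-sequence of
the coefficient sequence, Mathlib `Ext.covariant_sequence_exact₂`; the first map *is* the action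
of `ℓᵐ ∈ ℤ_ℓ`, `ProetCohomology.smul_def`). Milne: `⋯ → Hʳ(F) →ˡˢ Hʳ(F) → Hʳ(F_s) → ⋯`, i.e.
`0 → Hʳ(F)^{(lˢ)} → Hʳ(F_s)` (V Lemma 1.11). [cite: Milne2025, V Lemma 1.11] -/
theorem ProetCohomology.exists_pow_smul_eq_of_map_reductionHom_eq_zero (i : ℕ)
    (x : ProetCohomology X ℤ_[ℓ] i)
    (hx : ProetCohomology.map X (reductionHom ℓ m) (continuous_reductionHom ℓ m) i x = 0) :
    ∃ y : ProetCohomology X ℤ_[ℓ] i, ((ℓ : ℤ_[ℓ]) ^ m) • y = x :=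
  Abelian.Ext.covariant_sequence_exact₂ _ (powSMulShortComplex_shortExact X ℓ m) x hx

/-- The trivial half of the exactness: `ℓᵐ y` reduces to `0` in `Hⁱ(X_proét, ℤ/ℓᵐ)`.
[cite: Milne2025, V Lemma 1.11] -/
theorem ProetCohomology.map_reductionHom_pow_smul (i : ℕ) (y : ProetCohomology X ℤ_[ℓ] i) :
    ProetCohomology.map X (reductionHom ℓ m) (continuous_reductionHom ℓ m) i
      (((ℓ : ℤ_[ℓ]) ^ m) • y) = 0 := by
  rw [ProetCohomology.smul_def, ← ProetCohomology.map_comp X _ _ _ _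
      ((continuous_reductionHom ℓ m).comp (continuous_powSMulHom ℓ m)),
    ProetCohomology.map_congr (reductionHom_comp_powSMulHom ℓ m) _ continuous_const,
    ProetCohomology.map_zero']

end ExactSequence

/-! ### Milne V Lemma 1.11: the algebraic core and the separatedness -/

section Finiteness

variable (X : Scheme.{u}) (ℓ : ℕ) [Fact ℓ.Prime]

/-- **Milne V Lemma 1.11, algebraic core (proved).** If `Hⁱ(X_proét, ℤ/ℓ)` is finite and no
non-zero element of `M = Hⁱ(X_proét, ℤ_ℓ)` is divisible by all powers of `ℓ`, then `M` is a
finitely generated `ℤ_ℓ`-module (canonical structure). Printed argument (p. 178): "it follows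
that `Hʳ(F)` is generated by any subset that generates it mod `l`" — here: `M` is `ℓ`-adically
separated (`IsHausdorff`), `M/ℓM` embeds in the finite `Hⁱ(X_proét, ℤ/ℓ)`
(`exists_pow_smul_eq_of_map_reductionHom_eq_zero` with `m = 1`), so finitely many classes generate
`M` modulo `ℓM = 𝔪_{ℤ_ℓ} M`, hence generate `M` by Matsumura Thm. 8.4 over the complete ring
`ℤ_ℓ` (`Literature.AlgebraicGeometry.Resolution.Matsumura1987_8_4_finset`).
[cite: Milne2025, V Lemma 1.11] -/
theorem ProetCohomology.module_finite_of_finite_of_separated (i : ℕ)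
    (hfin : Finite (ProetCohomology X (ZMod (ℓ ^ 1)) i))
    (hsep : ∀ x : ProetCohomology X ℤ_[ℓ] i,
      (∀ m : ℕ, ∃ y : ProetCohomology X ℤ_[ℓ] i, ((ℓ : ℤ_[ℓ]) ^ m) • y = x) → x = 0) :
    Module.Finite ℤ_[ℓ] (ProetCohomology X ℤ_[ℓ] i) := by
  classical
  set M := ProetCohomology X ℤ_[ℓ] i
  set I : Ideal ℤ_[ℓ] := IsLocalRing.maximalIdeal ℤ_[ℓ]
  have hI : I = Ideal.span {(ℓ : ℤ_[ℓ])} := PadicInt.maximalIdeal_eq_span_p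
  -- `M` is `ℓ`-adically separated
  haveI : IsHausdorff I M := ⟨fun x hx => hsep x fun m => by
    have hm : x ∈ (I ^ m • ⊤ : Submodule ℤ_[ℓ] M) := (SModEq.zero).1 (hx m)
    rw [hI, Ideal.span_singleton_pow, Submodule.ideal_span_singleton_smul,
      Submodule.mem_smul_pointwise_iff_exists] at hm
    obtain ⟨y, -, hy⟩ := hm
    exact ⟨y, hy⟩⟩
  -- the reduction `M → Hⁱ(X_proét, ℤ/ℓ)` has kernel `⊆ ℓM = IM`
  let q := ProetCohomology.map X (reductionHom ℓ 1) (continuous_reductionHom ℓ 1) i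
  have hker : ∀ x : M, q x = 0 → x ∈ (I • ⊤ : Submodule ℤ_[ℓ] M) := fun x hx => by
    obtain ⟨y, rfl⟩ :=
      ProetCohomology.exists_pow_smul_eq_of_map_reductionHom_eq_zero X ℓ 1 i x hx
    rw [pow_one]
    exact Submodule.smul_mem_smul (hI ▸ Ideal.mem_span_singleton_self (ℓ : ℤ_[ℓ]))
      Submodule.mem_top
  -- finitely many classes represent all values of `q`
  obtain ⟨T, hT⟩ : ∃ T : Finset M, ∀ x : M, ∃ t ∈ T, q t = q x := by
    haveI : Fintype (Set.range q) := Fintype.ofFinite _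
    refine ⟨Finset.univ.image fun v : Set.range q => v.2.choose, fun x => ?_⟩
    exact ⟨_, Finset.mem_image_of_mem _ (Finset.mem_univ (⟨q x, x, rfl⟩ : Set.range q)),
      (Exists.choose_spec (⟨x, rfl⟩ : q x ∈ Set.range q))⟩
  -- they generate `M` modulo `IM`, hence generate `M` (Matsumura 8.4)
  have hsup : Submodule.span ℤ_[ℓ] (T : Set M) ⊔ (I • ⊤ : Submodule ℤ_[ℓ] M) = ⊤ :=
    eq_top_iff.2 fun x _ => by
      obtain ⟨t, ht, hqt⟩ := hT x
      have hx : x = t + (x - t) := by abel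
      rw [hx]
      exact Submodule.add_mem_sup (Submodule.subset_span ht)
        (hker _ (by rw [map_sub, hqt, sub_self]))
  exact ⟨⟨T, Literature.AlgebraicGeometry.Resolution.Matsumura1987_8_4_finset I T hsup⟩⟩

/-- **Separatedness in degree `0` (proved unconditionally).** No non-zero element of
`H⁰(X_proét, ℤ_ℓ) = C(X, ℤ_ℓ)` (`proetCohomologyZeroEquiv`) is divisible by all powers of `ℓ`:
such a function takes values in `⋂_m ℓᵐℤ_ℓ = 0` (`ℤ_ℓ` is `ℓ`-adically separated, Mathlib
`IsAdicComplete (maximalIdeal ℤ_[p]) ℤ_[p]`). [folklore] -/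
theorem ProetCohomology.eq_zero_of_forall_nsmul_zero (x : ProetCohomology X ℤ_[ℓ] 0)
    (hx : ∀ m : ℕ, ∃ y : ProetCohomology X ℤ_[ℓ] 0, ℓ ^ m • y = x) : x = 0 := by
  apply (proetCohomologyZeroEquiv X ℤ_[ℓ]).injective
  rw [map_zero]
  ext t
  refine IsHausdorff.haus' (I := IsLocalRing.maximalIdeal ℤ_[ℓ]) _ fun m => ?_
  obtain ⟨y, rfl⟩ := hx m
  rw [SModEq.zero, PadicInt.maximalIdeal_eq_span_p, Ideal.span_singleton_pow,
    Submodule.ideal_span_singleton_smul, map_nsmul, ContinuousMap.coe_nsmul, Pi.smul_apply,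
    ← Nat.cast_smul_eq_nsmul ℤ_[ℓ], Nat.cast_pow]
  exact Submodule.smul_mem_pointwise_smul _ _ _ Submodule.mem_top

/-- **`H⁰_proét(X, ℤ_ℓ)` is a finitely generated `ℤ_ℓ`-module as soon as `H⁰(X_proét, ℤ/ℓ)` is
finite** (canonical structure; proved: the algebraic core with the unconditional separatedness in
degree `0`). [cite: Milne2025, V Lemma 1.11] -/
theorem ProetCohomology.module_finite_zero_of_finite
    (hfin : Finite (ProetCohomology X (ZMod (ℓ ^ 1)) 0)) :
    Module.Finite ℤ_[ℓ] (ProetCohomology X ℤ_[ℓ] 0) :=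
  ProetCohomology.module_finite_of_finite_of_separated X ℓ 0 hfin fun x hx =>
    ProetCohomology.eq_zero_of_forall_nsmul_zero X ℓ x fun m => by
      obtain ⟨y, hy⟩ := hx m
      exact ⟨y, by rw [← hy, ← Nat.cast_smul_eq_nsmul ℤ_[ℓ], Nat.cast_pow]⟩

/-- **Degree `0` of the module-level finiteness for proper schemes, unconditionally** (and
over any field): for `Y → Spec K` proper, `H⁰_proét(Y, ℤ_ℓ)` is a finitely generated `ℤ_ℓ`-module
for its canonical structure, because `H⁰(Y_proét, ℤ/ℓ) = C(Y, ℤ/ℓ)` is finite for the Noetherian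
`Y` (`finite_proetCohomology_zmod_zero_of_isProper`, Part II). (`H⁰_proét(Y, ℤ_ℓ) = C(Y, ℤ_ℓ)`
is in fact free of rank the number of connected components; not needed.)
[cite: Milne2025, V Lemma 1.11 and VI Cor. 2.8] -/
theorem module_finite_proetCohomology_padicInt_zero_of_isProper {K : Type u} [Field K]
    {Y : Scheme.{u}} (f : Y ⟶ Spec (CommRingCat.of K)) [IsProper f] (ℓ : ℕ) [Fact ℓ.Prime] :
    Module.Finite ℤ_[ℓ] (ProetCohomology Y ℤ_[ℓ] 0) :=
  haveI : NeZero (ℓ ^ 1) := ⟨pow_ne_zero 1 (Fact.out : ℓ.Prime).ne_zero⟩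
  ProetCohomology.module_finite_zero_of_finite Y ℓ
    (finite_proetCohomology_zmod_zero_of_isProper f (ℓ ^ 1))

end Finiteness

end Literature.AlgebraicGeometry.Motives

end
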